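import Literature.NumberTheory.NumberFields.InertiaGeneratesGalois
import Mathlib.FieldTheory.Galois.Basic
import HarnessLib

/-!
# Ramification of a prime in the subfields of a Galois number field, via inertia groups

Let `L` be a Galois number field with group `G = Gal(L/ℚ)` and `Q` a maximal ideal of `𝓞 L`.
For a subfield `F` (an `IntermediateField ℚ L`, with `H_F = Gal(L/F) = F.fixingSubgroup`) the
prime `Q_F = Q ∩ 𝓞 F` below `Q` is unramified over `ℤ` iff the inertia group `I(Q) ≤ G` is
contained in `H_F` (`isUnramifiedAt_under_iff_inertia_le`) — the inertia field of `Q` is the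
largest subfield in which the prime below `Q` does not ramify (Serre, *Local Fields*, Ch. I §7,
Prop. 21–22; Marcus, *Number Fields*, Ch. 4, Thm. 28).  Proof: `e(Q|ℤ) = e(Q_F|ℤ) e(Q|Q_F)`
(Mathlib `Ideal.ramificationIdx_tower`) with `e(Q|ℤ) = #I(Q)` and `e(Q|Q_F) = #(I(Q) ∩ H_F)`
(`card_inertia_eq_ramificationIdx`, `InertiaGeneratesGalois.lean`).

This turns the bookkeeping of ramification in compositions and subfields into subgroup algebra:
`isUnramifiedAt_under_sup` (`H_{F₁F₂} = H_{F₁} ∩ H_{F₂}`), `isUnramifiedAt_under_of_le`, and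
`forall_isUnramifiedAt_iff_forall_inertia_le` ("`F` is unramified outside `p`" iff `I(Q) ≤ H_F`
for all `Q ∌ p`), as used in the proof of the Kronecker–Weber theorem (Marcus, Ch. 4, Ex. 29–31,
36: the compositum `KL` and the fields `K'`, `K'L = KL`).

## References

* J.-P. Serre, *Local Fields*, GTM 67 (1979), Ch. I §7, Prop. 21–22. [SerreLocalFields1979]
* D. A. Marcus, *Number Fields*, 2nd ed. (2018), Ch. 4, Thm. 28 and Ex. 29–31. [Marcus2018]
-/

noncomputable section

open NumberField Ideal
open scoped Pointwise

namespace Literature.NumberTheory.NumberFields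

variable (L : Type*) [Field L] [NumberField L] [IsGalois ℚ L]

omit [IsGalois ℚ L] in
/-- For a group `Γ` acting on the number field `L` through an injection `f : Γ → Gal(L/ℚ)`, the
inertia group of a maximal ideal `Q ⊆ 𝓞 L` in `Γ` is identified with `I(Q) ∩ f(Γ)`; for
`Γ = Gal(L/F)` this is Serre, *Local Fields*, Ch. I §7, Prop. 22 a) (`T(L/F) = T(L/K) ∩ G(L/F)`).
[folklore] -/
theorem card_inertia_eq_card_inf_range {Γ : Type*} [Group Γ] [MulSemiringAction Γ L]
    (Q : Ideal (𝓞 L)) (f : Γ →* (L ≃ₐ[ℚ] L)) (hinj : Function.Injective f)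
    (hf : ∀ (γ : Γ) (x : 𝓞 L), f γ • x = γ • x) :
    Nat.card (Q.inertia Γ) =
      Nat.card (Q.inertia (L ≃ₐ[ℚ] L) ⊓ f.range : Subgroup (L ≃ₐ[ℚ] L)) := by
  refine Nat.card_congr (Equiv.ofBijective
    (fun γ => ⟨f γ, fun x => by rw [hf]; exact γ.2 x, γ.1, rfl⟩) ⟨?_, ?_⟩)
  · intro a b h
    exact Subtype.ext (hinj (congrArg (fun t : ↥(Q.inertia (L ≃ₐ[ℚ] L) ⊓ f.range) => (t : L ≃ₐ[ℚ] L)) h))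
  · rintro ⟨g, hgI, γ, rfl⟩
    exact ⟨⟨γ, fun x => by rw [← hf]; exact hgI x⟩, rfl⟩

/-- **Ramification in subfields via inertia groups.**  Let `L` be a Galois number field with
group `G`, `F` a subfield with `H_F = Gal(L/F)`, and `Q` a maximal ideal of `𝓞 L` with
`Q_F = Q ∩ 𝓞 F`.  Then `Q_F` is unramified over `ℤ` iff the inertia group `I(Q) ≤ G` is contained
in `H_F`: `e(Q|ℤ) = e(Q_F|ℤ) · e(Q|Q_F)` with `e(Q|ℤ) = #I(Q)` and `e(Q|Q_F) = #(I(Q) ∩ H_F)`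
(Serre, Ch. I §7, Prop. 21–22: `T(L/F) = T(L/ℚ) ∩ G(L/F)`; equivalently, the inertia field of
`Q` is the largest subfield in which the prime below `Q` is unramified, Marcus Ch. 4 Thm. 28).
[cite: SerreLocalFields1979, Ch. I §7 Prop. 21–22] -/
theorem isUnramifiedAt_under_iff_inertia_le (F : IntermediateField ℚ L) (Q : Ideal (𝓞 L))
    [Q.IsMaximal] :
    Algebra.IsUnramifiedAt ℤ (Q.under (𝓞 F)) ↔ Q.inertia (L ≃ₐ[ℚ] L) ≤ F.fixingSubgroup := by
  haveI : IsGaloisGroup F.fixingSubgroup F L :=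
    IsGaloisGroup.intermediateField (L ≃ₐ[ℚ] L) ℚ L F
  haveI : (Q.under (𝓞 F)).IsMaximal := Ideal.IsMaximal.under (𝓞 F) Q
  have htower := ramificationIdx_tower (R := ℤ) (Q.under (𝓞 F)) Q
  rw [← card_inertia_eq_ramificationIdx_int L (L ≃ₐ[ℚ] L) Q,
    ← card_inertia_eq_ramificationIdx L F.fixingSubgroup F Q,
    card_inertia_eq_card_inf_range L Q F.fixingSubgroup.subtype F.fixingSubgroup.subtype_injective
      (fun _ _ => rfl), Subgroup.range_subtype] at htower
  -- `#I(Q) = e(Q_F|ℤ) · #(I(Q) ⊓ H_F)`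
  have hpos : 0 < Nat.card (Q.inertia (L ≃ₐ[ℚ] L)) := Nat.card_pos
  rw [← Ideal.ramificationIdx_eq_one_iff]
  constructor
  · intro h1
    rw [h1, one_mul] at htower
    have heq : Q.inertia (L ≃ₐ[ℚ] L) ⊓ F.fixingSubgroup = Q.inertia (L ≃ₐ[ℚ] L) :=
      Subgroup.eq_of_le_of_card_ge inf_le_left htower.le
    exact (inf_eq_left.mp heq)
  · intro hle
    rw [inf_eq_left.mpr hle] at htower
    exact (Nat.eq_of_mul_eq_mul_right hpos (htower.symm.trans (one_mul _).symm))

variable {L}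

/-- If the primes of two subfields `F₁`, `F₂` below `Q` are unramified over `ℤ`, so is the prime
of the compositum `F₁ F₂` below `Q` (`Gal(L/F₁F₂) = Gal(L/F₁) ∩ Gal(L/F₂)` contains `I(Q)`).
[folklore] -/
theorem isUnramifiedAt_under_sup {F₁ F₂ : IntermediateField ℚ L} {Q : Ideal (𝓞 L)} [Q.IsMaximal]
    (h₁ : Algebra.IsUnramifiedAt ℤ (Q.under (𝓞 F₁)))
    (h₂ : Algebra.IsUnramifiedAt ℤ (Q.under (𝓞 F₂))) :
    Algebra.IsUnramifiedAt ℤ (Q.under (𝓞 (F₁ ⊔ F₂ : IntermediateField ℚ L))) := by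
  rw [isUnramifiedAt_under_iff_inertia_le] at h₁ h₂ ⊢
  rw [IntermediateField.fixingSubgroup_sup]
  exact le_inf h₁ h₂

/-- If the prime of `F₂` below `Q` is unramified over `ℤ` and `F₁ ≤ F₂`, so is the prime of `F₁`
below `Q`. [folklore] -/
theorem isUnramifiedAt_under_of_le {F₁ F₂ : IntermediateField ℚ L} (hle : F₁ ≤ F₂)
    {Q : Ideal (𝓞 L)} [Q.IsMaximal] (h₂ : Algebra.IsUnramifiedAt ℤ (Q.under (𝓞 F₂))) :
    Algebra.IsUnramifiedAt ℤ (Q.under (𝓞 F₁)) := by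
  rw [isUnramifiedAt_under_iff_inertia_le] at h₂ ⊢
  exact h₂.trans (IntermediateField.fixingSubgroup_antitone hle)

/-- **"Unramified outside `p`" for a subfield, read on `𝓞 L`.**  For a subfield `F` of the
Galois number field `L` and a rational prime `p`: every maximal ideal of `𝓞 F` not containing `p`
is unramified over `ℤ` iff `I(Q) ≤ Gal(L/F)` for every maximal ideal `Q` of `𝓞 L` not
containing `p`. [folklore] -/
theorem forall_isUnramifiedAt_iff_forall_inertia_le (F : IntermediateField ℚ L) (p : ℕ) :
    (∀ (q : Ideal (𝓞 F)) [q.IsMaximal], (p : 𝓞 F) ∉ q → Algebra.IsUnramifiedAt ℤ q) ↔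
      ∀ (Q : Ideal (𝓞 L)) [Q.IsMaximal], (p : 𝓞 L) ∉ Q →
        Q.inertia (L ≃ₐ[ℚ] L) ≤ F.fixingSubgroup := by
  constructor
  · intro h Q _ hpQ
    rw [← isUnramifiedAt_under_iff_inertia_le]
    haveI : (Q.under (𝓞 F)).IsMaximal := Ideal.IsMaximal.under (𝓞 F) Q
    refine h (Q.under (𝓞 F)) fun hp => hpQ ?_
    rw [Ideal.under_def, Ideal.mem_comap, map_natCast] at hp
    exact hp
  · intro h q _ hpq
    obtain ⟨Q, hQmax, hQover⟩ := Ideal.exists_maximal_ideal_liesOver_of_isIntegral (S := 𝓞 L) q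
    have hq : q = Q.under (𝓞 F) := hQover.over
    have hpQ : (p : 𝓞 L) ∉ Q := fun hp => hpq (by
      rw [hq, Ideal.under_def, Ideal.mem_comap, map_natCast]; exact hp)
    subst hq
    rw [isUnramifiedAt_under_iff_inertia_le]
    exact h Q hpQ

end Literature.NumberTheory.NumberFields
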